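import Literature.AlgebraicGeometry.Frobenioids.Factorization
import Literature.AlgebraicGeometry.Frobenioids.MonoidTransport
import HarnessLib

/-!
# Frobenioids I, Def. 2.4 (i)(c)(d): invariance of the factorization conditions under isomorphism

Mochizuki, *The geometry of Frobenioids I*, Kyushu J. Math. **62** (2008), §2, Definition 2.4 (i),
kurims pp. 47–48 [cite: MochizukiFrdI2008, Def. 2.4(i) p.47].

For an isomorphism of monoids `e : Q ≅ Q'` the factorization data of `Factorization.lean` correspond:
`Prime(Q) ≅ Prime(Q')` (`Primes.congr e`), `Q_𝔮 ≅ Q'_{e𝔮}`, `Q_𝔮 ⊗ ℝ_{≥0} ≅ Q'_{e𝔮} ⊗ ℝ_{≥0}`, hence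
isomorphisms of the products `∏ Q_𝔮 ≅ ∏ Q'_{𝔮'}` (`piP`) and `∏ Q_𝔮 ⊗ ℝ_{≥0} ≅ ∏ Q'_{𝔮'} ⊗ ℝ_{≥0}`
(`piR`) under which `Bound_{𝔮 ∪ {0}}(a)` corresponds to `Bound_{e𝔮 ∪ {0}}(e a)` (`bound_congr`), the
factorization maps correspond (`fmap_congr`: `fmap(e a) = piR (fmap a)`, using that suprema in
`N ⊗ ℝ_{≥0}` are unique) and supports correspond (`supp_piR`).  Consequently **conditions (c), (d) of
Def. 2.4 (i) are invariant under isomorphism** (`Factorization.Cond.of_mulEquiv`) — the content of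
the paper's tacit identifications `(M^pf)^pf = M^pf`, `(M^rlf)^pf = M^rlf` in "one verifies
immediately that `M^pf`, `M^rlf` are also perf-factorial" (p. 48).  Index bookkeeping: every fibrewise
isomorphism is stated for a pair of primes `𝔮, 𝔮'` with an equation `Primes.congr e 𝔮 = 𝔮'`, so no
transport of dependent types along equalities of primes is needed.  No statement of the paper is
strengthened.
-/

noncomputable section

namespace Literature.AlgebraicGeometry.Frobenioids

namespace Factorization

open Function

universe u

variable {Q Q' : Type u} [CommMonoid Q] [CommMonoid Q'] (e : Q ≃* Q')

/-- `Q_𝔮 ≅ Q'_{𝔮'}` for `𝔮' = e(𝔮)` (restriction of `e`). [cite: MochizukiFrdI2008, Def. 2.4(i) p.47] -/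
abbrev subEquiv (𝔮 : Primes Q) (𝔮' : Primes Q') (h : Primes.congr e 𝔮 = 𝔮') : PAt Q 𝔮 ≃* PAt Q' 𝔮' :=
  Primes.submonoidCongr e 𝔮 𝔮' h

/-- `Q_𝔮 ⊗ ℝ_{≥0} ≅ Q'_{𝔮'} ⊗ ℝ_{≥0}` for `𝔮' = e(𝔮)`. [cite: MochizukiFrdI2008, Def. 2.4(i) p.47] -/
abbrev rlfEquiv (𝔮 : Primes Q) (𝔮' : Primes Q') (h : Primes.congr e 𝔮 = 𝔮') : RAt Q 𝔮 ≃* RAt Q' 𝔮' :=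
  Realification.congr (subEquiv e 𝔮 𝔮' h)

/-- The prime of `Q` under `𝔮' ∈ Prime(Q')`. [cite: MochizukiFrdI2008, Def. 2.4(i) p.47] -/
abbrev pre (𝔮' : Primes Q') : Primes Q := Primes.congr e.symm 𝔮'

/-- `e (pre 𝔮') = 𝔮'`. [cite: MochizukiFrdI2008, Def. 2.4(i) p.47] -/
theorem congr_pre (𝔮' : Primes Q') : Primes.congr e (pre e 𝔮') = 𝔮' :=
  Primes.congr_apply_congr_symm e 𝔮'

/-- `pre (e 𝔮) = 𝔮`. [cite: MochizukiFrdI2008, Def. 2.4(i) p.47] -/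
theorem pre_congr (𝔮 : Primes Q) : pre e (Primes.congr e 𝔮) = 𝔮 :=
  Primes.congr_symm_apply_congr e 𝔮

/-! ### The product isomorphisms -/

/-- `∏_𝔮 Q_𝔮 → ∏_{𝔮'} Q'_{𝔮'}`, `(x_𝔮) ↦ (e x_{e⁻¹𝔮'})_{𝔮'}`. [cite: MochizukiFrdI2008, Def. 2.4(i) p.47] -/
def piP : PFactor Q →* PFactor Q' where
  toFun x 𝔮' := subEquiv e (pre e 𝔮') 𝔮' (congr_pre e 𝔮') (x (pre e 𝔮'))
  map_one' := funext fun 𝔮' => by rw [Pi.one_apply, map_one]; rfl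
  map_mul' x y := funext fun 𝔮' => by rw [Pi.mul_apply, map_mul]; rfl

/-- `piP` componentwise. [cite: MochizukiFrdI2008, Def. 2.4(i) p.47] -/
theorem piP_apply (x : PFactor Q) (𝔮' : Primes Q') :
    piP e x 𝔮' = subEquiv e (pre e 𝔮') 𝔮' (congr_pre e 𝔮') (x (pre e 𝔮')) := rfl

/-- `∏_𝔮 Q_𝔮 ⊗ ℝ_{≥0} → ∏_{𝔮'} Q'_{𝔮'} ⊗ ℝ_{≥0}`. [cite: MochizukiFrdI2008, Def. 2.4(i) p.47] -/
def piR : RFactor Q →* RFactor Q' where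
  toFun a 𝔮' := rlfEquiv e (pre e 𝔮') 𝔮' (congr_pre e 𝔮') (a (pre e 𝔮'))
  map_one' := funext fun 𝔮' => by rw [Pi.one_apply, map_one]; rfl
  map_mul' a b := funext fun 𝔮' => by rw [Pi.mul_apply, map_mul]; rfl

/-- `piR` componentwise. [cite: MochizukiFrdI2008, Def. 2.4(i) p.47] -/
theorem piR_apply (a : RFactor Q) (𝔮' : Primes Q') :
    piR e a 𝔮' = rlfEquiv e (pre e 𝔮') 𝔮' (congr_pre e 𝔮') (a (pre e 𝔮')) := rfl

/-- `piR` is injective. [cite: MochizukiFrdI2008, Def. 2.4(i) p.47] -/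
theorem piR_injective : Injective (piR e) := by
  intro a b h
  funext 𝔮
  have h1 := congr_fun h (Primes.congr e 𝔮)
  rw [piR_apply, piR_apply] at h1
  have h2 := (rlfEquiv e _ _ _).injective h1
  rwa [pre_congr] at h2

/-- Index bookkeeping for `piR`: transporting out of `e 𝔮₀` and back into `𝔮' = e 𝔮₀` is the identity.
[cite: MochizukiFrdI2008, Def. 2.4(i) p.47] -/
theorem rlfEquiv_symm_cancel (a' : RFactor Q') (𝔮₀ : Primes Q) (𝔮' : Primes Q')
    (h : Primes.congr e 𝔮₀ = 𝔮') :
    rlfEquiv e 𝔮₀ 𝔮' h ((rlfEquiv e 𝔮₀ (Primes.congr e 𝔮₀) rfl).symm (a' (Primes.congr e 𝔮₀))) = a' 𝔮' := by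
  subst h
  exact MulEquiv.apply_symm_apply _ _

/-- `piR` is surjective (explicit preimage). [cite: MochizukiFrdI2008, Def. 2.4(i) p.47] -/
theorem piR_surjective : Surjective (piR e) := by
  intro a'
  refine ⟨fun 𝔮 => (rlfEquiv e 𝔮 (Primes.congr e 𝔮) rfl).symm (a' (Primes.congr e 𝔮)), ?_⟩
  funext 𝔮'
  rw [piR_apply]
  exact rlfEquiv_symm_cancel e a' (pre e 𝔮') 𝔮' (congr_pre e 𝔮')

/-- Index bookkeeping for `piP`. [cite: MochizukiFrdI2008, Def. 2.4(i) p.47] -/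
theorem subEquiv_symm_cancel (x' : PFactor Q') (𝔮₀ : Primes Q) (𝔮' : Primes Q')
    (h : Primes.congr e 𝔮₀ = 𝔮') :
    subEquiv e 𝔮₀ 𝔮' h ((subEquiv e 𝔮₀ (Primes.congr e 𝔮₀) rfl).symm (x' (Primes.congr e 𝔮₀))) = x' 𝔮' := by
  subst h
  exact MulEquiv.apply_symm_apply _ _

/-- `piP` is surjective (explicit preimage). [cite: MochizukiFrdI2008, Def. 2.4(i) p.47] -/
theorem piP_surjective : Surjective (piP e) := by
  intro x'
  refine ⟨fun 𝔮 => (subEquiv e 𝔮 (Primes.congr e 𝔮) rfl).symm (x' (Primes.congr e 𝔮)), ?_⟩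
  funext 𝔮'
  rw [piP_apply]
  exact subEquiv_symm_cancel e x' (pre e 𝔮') 𝔮' (congr_pre e 𝔮')

/-- `piR ∘ pToR = pToR' ∘ piP` (naturality of `N → N ⊗ ℝ_{≥0}`). [cite: MochizukiFrdI2008, Def. 2.4(i) p.47] -/
theorem piR_pToR (x : PFactor Q) : piR e (pToR Q x) = pToR Q' (piP e x) := by
  funext 𝔮'
  rw [piR_apply, pToR_apply, pToR_apply, piP_apply]
  exact Realification.congr_of _ _

/-- Supports under `piR`: `Supp(piR a) = e(Supp(a))`. [cite: MochizukiFrdI2008, Def. 2.4(i) p.47] -/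
theorem supp_piR (a : RFactor Q) : supp (piR e a) = (Primes.congr e.symm) ⁻¹' supp a := by
  ext 𝔮'
  simp only [supp, Set.mem_setOf_eq, Set.mem_preimage, piR_apply, ne_eq,
    EmbeddingLike.map_eq_one_iff]

/-! ### `Bound` and the factorization map under `e` -/

/-- **`Bound_{e𝔮 ∪ {0}}(e a) = ρ(Bound_{𝔮 ∪ {0}}(a))`** for the fibre isomorphism `ρ`.
[cite: MochizukiFrdI2008, Def. 2.4(i) p.47] -/
theorem bound_congr (𝔮₀ : Primes Q) (𝔮' : Primes Q') (h : Primes.congr e 𝔮₀ = 𝔮') (a : Q) :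
    bound Q' 𝔮' (e a) = rlfEquiv e 𝔮₀ 𝔮' h '' bound Q 𝔮₀ a := by
  have key : ∀ y : Q', y ∈ 𝔮'.carrier ↔ e.symm y ∈ 𝔮₀.carrier := fun y => by
    rw [← h, Primes.mem_carrier_congr_iff]
  ext y'
  constructor
  · rintro ⟨x', hx', hx'a, rfl⟩
    refine ⟨Realification.of _ ((subEquiv e 𝔮₀ 𝔮' h).symm x'),
      ⟨(subEquiv e 𝔮₀ 𝔮' h).symm x', ?_, ?_, rfl⟩, ?_⟩
    · rw [Primes.coe_submonoidCongr_symm_apply]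
      rcases hx' with hx' | hx'
      · left
        exact (key _).mp hx'
      · right
        rw [hx', map_one]
    · rw [Primes.coe_submonoidCongr_symm_apply]
      have := map_dvd (e.symm : Q' →* Q) hx'a
      rwa [MonoidHom.coe_coe, e.symm_apply_apply] at this
    · rw [Realification.congr_of, MulEquiv.apply_symm_apply]
  · rintro ⟨y, ⟨x, hx, hxa, rfl⟩, rfl⟩
    refine ⟨subEquiv e 𝔮₀ 𝔮' h x, ?_, ?_, (Realification.congr_of _ _)⟩
    · rw [Primes.coe_submonoidCongr_apply]
      rcases hx with hx | hx
      · left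
        rw [key, e.symm_apply_apply]
        exact hx
      · right
        rw [hx, map_one]
    · rw [Primes.coe_submonoidCongr_apply]
      exact map_dvd (e : Q →* Q') hxa

/-- **The factorization maps correspond**: `fmap(e a) = piR (fmap a)` (suprema in `N ⊗ ℝ_{≥0}` are
unique, so they are preserved by the fibre isomorphisms). [cite: MochizukiFrdI2008, Def. 2.4(i) p.47] -/
theorem fmap_congr (a : Q) : fmap Q' (e a) = piR e (fmap Q a) := by
  funext 𝔮'
  rw [piR_apply, fmap, fmap, bound_congr e (pre e 𝔮') 𝔮' (congr_pre e 𝔮') a]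
  exact (map_divSup _ (fun _ _ => Realification.dvd_antisymm) _).symm

/-! ### Transport of conditions (c), (d) -/

/-- **Conditions (c), (d) of Def. 2.4 (i) are invariant under isomorphisms of monoids.**
[cite: MochizukiFrdI2008, Def. 2.4(i) p.47] -/
theorem Cond.of_mulEquiv (e : Q ≃* Q') (hc : Cond Q) : Cond Q' where
  bounded 𝔮' a' := by
    obtain ⟨a, rfl⟩ := e.surjective a'
    obtain ⟨b, hb⟩ := hc.bounded (pre e 𝔮') a
    rw [bound_congr e (pre e 𝔮') 𝔮' (congr_pre e 𝔮') a]
    exact ⟨_, (isBoundedBy_image_iff _ _ b).mpr hb⟩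
  fmap_one := by rw [← map_one e, fmap_congr, hc.fmap_one, map_one]
  fmap_mul a' b' := by
    obtain ⟨a, rfl⟩ := e.surjective a'
    obtain ⟨b, rfl⟩ := e.surjective b'
    rw [← map_mul, fmap_congr, fmap_congr, fmap_congr, hc.fmap_mul, map_mul]
  fmap_injective a' b' hab := by
    obtain ⟨a, rfl⟩ := e.surjective a'
    obtain ⟨b, rfl⟩ := e.surjective b'
    rw [fmap_congr, fmap_congr] at hab
    rw [hc.fmap_injective (piR_injective e hab)]
  fmap_mem_range a' := by
    obtain ⟨a, rfl⟩ := e.surjective a'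
    obtain ⟨x, hx⟩ := hc.fmap_mem_range a
    exact ⟨piP e x, by rw [fmap_congr, ← hx, piR_pToR]⟩
  mem_range_of_supp_subset x' b' hsupp := by
    obtain ⟨x, rfl⟩ := piP_surjective e x'
    obtain ⟨b, rfl⟩ := e.surjective b'
    rw [← piR_pToR, fmap_congr, supp_piR, supp_piR,
      (Primes.congr e.symm).surjective.preimage_subset_preimage_iff] at hsupp
    obtain ⟨c, hc'⟩ := hc.mem_range_of_supp_subset x b hsupp
    exact ⟨e c, by rw [fmap_congr, hc', piR_pToR]⟩

/-- (c), (d) for `Q` iff for `Q' ≅ Q`. [cite: MochizukiFrdI2008, Def. 2.4(i) p.47] -/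
theorem cond_congr_iff (e : Q ≃* Q') : Cond Q ↔ Cond Q' :=
  ⟨Cond.of_mulEquiv e, Cond.of_mulEquiv e.symm⟩

end Factorization

end Literature.AlgebraicGeometry.Frobenioids
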